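import Literature.NumberTheory.GaloisCohomology.Howard2004.QuotFunctoriality
import HarnessLib

/-!
# Howard 2004, Def. 1.1.3: the canonical quotient `T/IT` as a discrete Galois module (`modIdeal`)

Tranche 3d of (W9) (cell `pub/bsd-print-x9`; the object part of x9-p1 LEAD's (T3-iii)
«`restrictCoeff (I : Ideal R)` — levels `𝐓/(I + 𝔪^{e_k})`», 2026-08-28 14:56Z, at ONE level):
for an `R`-linear discrete `Γ_K`-module `T` (tree `DiscreteGaloisModule` + x10b-p2's
`IsScalarLinear`) and an ideal `I ⊆ R`, the quotient `T/IT` («`Quot(T)` … objects are quotients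
`T/IT` of `T` by ideals of `R`», arXiv:1202.6340 Def. 2.1.3, p. 5 L93–99) as a discrete
`Γ_K`-module on the `R`-module `T ⧸ I•T`, with its canonical presentation
`IsQuotientBy ρ I (modIdeal ρ hρ I) (mkQ)` (tranche 2) — so every consumer (the Kolyvagin
quotients `T^{(k)}/I_n` of `LevelData`, the ring change `𝐓/q_m𝐓` of Rem. 1.2.4 (iii)) has an
inhabitant of the presentation predicate without building one by hand.  Definitions with bodies
and proved lemmas only; no named fact, no `sorry`, no instance.
[cite: Howard2004HeegnerKolyvagin, Def. 1.1.3 (arXiv Def. 2.1.3, p. 5, L93–99)]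
-/

set_option autoImplicit false

noncomputable section

open Function Field
open scoped Classical

namespace Literature.NumberTheory.GaloisCohomology.Howard2004

open Literature.NumberTheory.GaloisRepresentations
open Literature.NumberTheory.GaloisRepresentations.DiscreteGaloisModule

namespace DiscreteGaloisModuleQuot

variable {K : Type} [Field K] {M : Type} [AddCommGroup M] [TopologicalSpace M]
  [DiscreteTopology M] {R : Type} [CommRing R] [Module R M]

/-- The operator `ρ σ` as an `R`-LINEAR map (it is one by `IsScalarLinear`). [cite: Howard2004HeegnerKolyvagin, §1 conventions, Mod_{R,K} (arXiv p. 5, L3–8)] -/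
def linearOp (ρ : DiscreteGaloisModule K M) (hρ : ρ.IsScalarLinear R) (σ : absoluteGaloisGroup K) :
    M →ₗ[R] M where
  toFun := ρ σ
  map_add' := map_add _
  map_smul' r m := hρ σ r m

/-- Unfolding `linearOp`. [cite: Howard2004HeegnerKolyvagin, §1 conventions (arXiv p. 5, L3–8)] -/
@[simp] theorem linearOp_apply (ρ : DiscreteGaloisModule K M) (hρ : ρ.IsScalarLinear R)
    (σ : absoluteGaloisGroup K) (m : M) : linearOp ρ hρ σ m = ρ σ m := rfl

/-- `I•T` is `Γ_K`-stable. [cite: Howard2004HeegnerKolyvagin, Def. 1.1.3 (arXiv p. 5, L93–99)] -/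
theorem smul_top_le_comap (ρ : DiscreteGaloisModule K M) (hρ : ρ.IsScalarLinear R) (I : Ideal R)
    (σ : absoluteGaloisGroup K) :
    (I • (⊤ : Submodule R M)) ≤ (I • (⊤ : Submodule R M)).comap (linearOp ρ hρ σ) := by
  rw [← Submodule.map_le_iff_le_comap, Submodule.map_smul'']
  exact Submodule.smul_mono le_rfl le_top

/-- The action of `σ` on `T ⧸ I•T`. [cite: Howard2004HeegnerKolyvagin, Def. 1.1.3 (arXiv p. 5, L93–99)] -/
def quotOp (ρ : DiscreteGaloisModule K M) (hρ : ρ.IsScalarLinear R) (I : Ideal R)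
    (σ : absoluteGaloisGroup K) :
    (M ⧸ (I • (⊤ : Submodule R M))) →ₗ[R] (M ⧸ (I • (⊤ : Submodule R M))) :=
  (I • (⊤ : Submodule R M)).mapQ (I • (⊤ : Submodule R M)) (linearOp ρ hρ σ)
    (smul_top_le_comap ρ hρ I σ)

/-- `quotOp` on classes. [cite: Howard2004HeegnerKolyvagin, Def. 1.1.3 (arXiv p. 5, L93–99)] -/
@[simp] theorem quotOp_mk (ρ : DiscreteGaloisModule K M) (hρ : ρ.IsScalarLinear R) (I : Ideal R)
    (σ : absoluteGaloisGroup K) (m : M) :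
    quotOp ρ hρ I σ (Submodule.Quotient.mk m) = Submodule.Quotient.mk (ρ σ m) := rfl

/-- The representation of `Γ_K` on `T ⧸ I•T` (as `ℤ`-linear maps, the tree's convention).
[cite: Howard2004HeegnerKolyvagin, Def. 1.1.3 (arXiv p. 5, L93–99)] -/
def quotRepresentation (ρ : DiscreteGaloisModule K M) (hρ : ρ.IsScalarLinear R) (I : Ideal R) :
    Representation ℤ (absoluteGaloisGroup K) (M ⧸ (I • (⊤ : Submodule R M))) where
  toFun σ := (quotOp ρ hρ I σ).toAddMonoidHom.toIntLinearMap
  map_one' := by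
    apply LinearMap.ext
    intro q
    induction q using Submodule.Quotient.induction_on with
    | _ m =>
      change Submodule.Quotient.mk (ρ 1 m) = Submodule.Quotient.mk m
      rw [map_one]
      rfl
  map_mul' σ τ := by
    apply LinearMap.ext
    intro q
    induction q using Submodule.Quotient.induction_on with
    | _ m =>
      change Submodule.Quotient.mk (ρ (σ * τ) m) =
        Submodule.Quotient.mk (ρ σ (ρ τ m))
      rw [map_mul]
      rfl

/-- Unfolding `quotRepresentation` on classes. [cite: Howard2004HeegnerKolyvagin, Def. 1.1.3 (arXiv p. 5, L93–99)] -/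
@[simp] theorem quotRepresentation_apply_mk (ρ : DiscreteGaloisModule K M)
    (hρ : ρ.IsScalarLinear R) (I : Ideal R) (σ : absoluteGaloisGroup K) (m : M) :
    quotRepresentation ρ hρ I σ (Submodule.Quotient.mk m) = Submodule.Quotient.mk (ρ σ m) := rfl

end DiscreteGaloisModuleQuot

open DiscreteGaloisModuleQuot

section ModIdeal

variable {K : Type} [Field K] {M : Type} [AddCommGroup M] [TopologicalSpace M]
  [DiscreteTopology M] {R : Type} [CommRing R] [Module R M]

/-- **`T/IT` as a discrete `Γ_K`-module** (the object of `Quot(T)` attached to the ideal `I`,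
Def. 1.1.3), on the `R`-module `T ⧸ I•T`; continuity: the stabiliser of `m mod IT` contains the
open stabiliser of `m`. [cite: Howard2004HeegnerKolyvagin, Def. 1.1.3 (arXiv Def. 2.1.3, p. 5, L93–99)] -/
def modIdeal (ρ : DiscreteGaloisModule K M) (hρ : ρ.IsScalarLinear R) (I : Ideal R) :
    DiscreteGaloisModule K (M ⧸ (I • (⊤ : Submodule R M))) :=
  ContinuousRep.ofStabilizerMemNhdsOne (quotRepresentation ρ hρ I) fun q => by
    induction q using Submodule.Quotient.induction_on with
    | _ m =>
      refine Filter.mem_of_superset (ρ.setOf_apply_eq_mem_nhds_one m) fun g hg => ?_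
      simp only [Set.mem_setOf_eq] at hg ⊢
      rw [quotRepresentation_apply_mk, hg]

/-- Unfolding `modIdeal` on classes: `σ · (m mod IT) = (σ m) mod IT`. [cite: Howard2004HeegnerKolyvagin, Def. 1.1.3 (arXiv p. 5, L93–99)] -/
@[simp] theorem modIdeal_apply_mk (ρ : DiscreteGaloisModule K M) (hρ : ρ.IsScalarLinear R)
    (I : Ideal R) (σ : absoluteGaloisGroup K) (m : M) :
    modIdeal ρ hρ I σ (Submodule.Quotient.mk m) = Submodule.Quotient.mk (ρ σ m) := rfl

/-- **The canonical presentation of `T/IT`**: the quotient map presents `modIdeal ρ hρ I` as the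
object `T/IT` of `Quot(T)` (tranche-2 `IsQuotientBy`). [cite: Howard2004HeegnerKolyvagin, Def. 1.1.3 (arXiv p. 5, L93–99)] -/
theorem isQuotientBy_modIdeal [NumberField K] (ρ : DiscreteGaloisModule K M)
    (hρ : ρ.IsScalarLinear R) (I : Ideal R) :
    IsQuotientBy ρ I (modIdeal ρ hρ I) (I • (⊤ : Submodule R M)).mkQ where
  surjective := Submodule.mkQ_surjective _
  ker_eq := Submodule.ker_mkQ _
  equivariant _ _ := rfl

/-- `T/IT` is `R`-linear. [cite: Howard2004HeegnerKolyvagin, Def. 1.1.3 (arXiv p. 5, L93–99)] -/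
theorem isScalarLinear_modIdeal (ρ : DiscreteGaloisModule K M) (hρ : ρ.IsScalarLinear R)
    (I : Ideal R) : (modIdeal ρ hρ I).IsScalarLinear R := by
  intro σ r q
  induction q using Submodule.Quotient.induction_on with
  | _ m =>
    change modIdeal ρ hρ I σ (Submodule.Quotient.mk (r • m)) = r • Submodule.Quotient.mk (ρ σ m)
    rw [modIdeal_apply_mk, hρ σ r m, Submodule.Quotient.mk_smul]

/-- `T/IT` as an `R/I`-module object (the ring-change view of tranche 3b applied to the canonical
presentation): the action is `R/I`-linear. [cite: Howard2004HeegnerKolyvagin, Rem. 1.2.4 (iii) (arXiv p. 7, L19–27)] -/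
theorem isScalarLinear_modIdeal_quotient [NumberField K] (ρ : DiscreteGaloisModule K M)
    (hρ : ρ.IsScalarLinear R) (I : Ideal R) :
    letI := (isQuotientBy_modIdeal ρ hρ I).moduleQuotient
    (modIdeal ρ hρ I).IsScalarLinear (R ⧸ I) :=
  (isQuotientBy_modIdeal ρ hρ I).isScalarLinear_quotient (isScalarLinear_modIdeal ρ hρ I)

end ModIdeal

end Literature.NumberTheory.GaloisCohomology.Howard2004
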